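import Summits.MatrixMultiplication.MatrixMultiplication.Theorems.SaturationLadderCornerGerm
import HarnessLib

/-!
# Route `SaturationLadder` on Strassen's spectrum, III: the CORNER MODULUS — the crux is `κ*(ℂ) = 0`

decomp-mm lens 1 «grading / quantitative ladder», gen 43, kernel K43-C (chain file 3; files 1–2 =
`SaturationLadderThinRoof`, `SaturationLadderCornerGerm`).  Def-free, sorry-free support beneath the deciding crux
`SubexpSaturation` (stmt-MatrixMultiplication-25909) of `route-MatrixMultiplication-SaturationLadder`; cut of record UNCHANGED
(`closes (h₁ : SubexpSaturation) (h₂ : SubexpToPoly) (h₃ : PolyToFinite) (h₄ : TailDescentTwo) (h₅ : SquareFromTwo)`).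

For a universal spectral point `φ` over `ℂ` write `θ = specMMPoint ℂ φ ∈ [0,1]³`, DARKNESS `d = θ₀+θ₁+θ₂−2`,
HEIGHT `θ₁`, DEPTH `ε₂ = 1−θ₂` below the light face `{θ₂ = 1}`, and `u = log(θ₁/ε₂)` (the logarithmic
height-to-depth ratio; `u → +∞` exactly at points approaching the face off the face).  The ONE-NUMBER form of the
deciding crux:

* §1 `face_light`: a universal spectral point ON the face (`θ₂ = 1`) is light (`θ₁ ≤ 1−θ₀`) — every field; from
  lens 2's far-edge tower read in file 1 (`height_le_tower`, `j → ∞`).  (The matrix-multiplication shadow of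
  Alman–Li–Pratt 2026, Thm. 1.5: spectral points with a unit coordinate are edge support functionals.)
* §2 ★★ `modulus_of_roofClauses`: if the thin roof clause holds at every rate `c > c₀` (`c₀ ≥ 0`), then for every
  `κ > c₀` there is `u₀` with **`d·u ≤ κ·θ₁`** at every universal spectral point with `u ≥ u₀`
  (choice `s = c/((1−η)u)`, `e^{c/s}ε₂ = θ₁e^{−ηu}`, `u e^{−ηu} ≤ 2/(η²u)`).
* §3 ★★ `roofClauses_of_modulus`: conversely `d·u ≤ κ·θ₁` for `u ≥ u₀` gives the roof clause at every rate `c > κ`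
  (`u(1−t) ≥ κ`: `d ≤ (1−t)θ₁`; `u(1−t) < κ < c`: `e^{c/(1−t)}ε₂ ≥ θ₁`; shallow points `u < u₀`: `e^{c/(1−t)} ≥ e^{u₀}`;
  face points: §1).
* §4 ★★★ `subexpSaturation_iff_modulus`: **`SubexpSaturation ⟺ ∀ κ > 0 ∃ u₀ ∀φ (u ≥ u₀): d·log(θ₁/ε₂) ≤ κ·θ₁`** —
  the crux says that ONE scalar, the CORNER MODULUS `κ*(ℂ) = limsup_{u→∞} d·u/θ₁` of the complex matrix-multiplication
  spectrum, VANISHES; and `modulus_above_classCeiling`: the lineage's certified rates (`clause(c)` for all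
  `c > c₂ = (5 log(5/4) + 3 log 2)/3 = 1.0650…`) are exactly the PROVED bound **`κ*(ℂ) ≤ c₂`**;
  `subexpSaturation_iff_modulus_le_classCeiling`: the crux ⟺ the modulus law for every `κ ∈ (0, c₂]`.

So the quantitative ladder of the route's LENGTH side is a ladder of upper bounds on one number:
`κ* ≤ log 4` (by hand from ExpSaturation, 25913, proved) → `κ* ≤ c₂` (class certificates; PROVED HERE) → [class floor `c⋆ = 1.0645958`,
no in-class certificate below] → `κ* = 0` (h₁).  Nothing here proves `ω = 2` or the crux; no definitions (gate rule
D-0009).  [cite: Strassen1988, Thm. 3.8] [cite: AlmanLi2026, Proposition 4.1; Proposition 4.2]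
[cite: CoppersmithWinograd1990, §8] [cite: LottiRomani1983, Prop. 4.1] [cite: AlmanDuanVassilevskaWilliamsXuXuZhou2025, §3.4]
-/

set_option linter.dupNamespace false

noncomputable section

open scoped BigOperators

namespace Summit.MatrixMultiplication.MatrixMultiplication.Theorems.SaturationLadderCornerModulus

open Literature.Computability.AlgebraicComplexity
open Summit.MatrixMultiplication.MatrixMultiplication.Theses.SaturationLadder
open Summit.MatrixMultiplication.MatrixMultiplication.Theorems.SaturationLadderThinRoof
open Summit.MatrixMultiplication.MatrixMultiplication.Theorems.SaturationLadderCornerGerm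
open Summit.MatrixMultiplication.MatrixMultiplication.Theorems.SaturationLadderGaugeConeClasses
  (classCeiling_pos)

variable {K : Type} [Field K]

/-! ## §1 Spectral points on the light face are light -/

/-- ★ **The light face is light**: a universal spectral point with `θ₂ = 1` has `θ₁ ≤ 1 − θ₀` (so it is light,
`θ₀+θ₁+θ₂ ≤ 2`), over every field — let `j → ∞` in the tower law `θ₁ ≤ ε₀ + 3·15ʲ·ε₂ + 2^{−j}` of file 1.
[cite: CoppersmithWinograd1982, Thm. 1] [cite: AlmanLiPratt2026, Thm. 1.5] -/
theorem face_light {F : SpectralMap K} (hF : IsUniversalSpectralPoint K F) (h2 : specMMPoint K F 2 = 1) :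
    specMMPoint K F 1 ≤ 1 - specMMPoint K F 0 := by
  by_contra hlt
  push Not at hlt
  obtain ⟨j, hj⟩ := exists_pow_lt_of_lt_one (sub_pos.2 hlt) (by norm_num : (1 / 2 : ℝ) < 1)
  have ht := height_le_tower hF j
  rw [h2, sub_self, mul_zero, add_zero] at ht
  rw [one_div_pow] at hj
  linarith

/-- **Face points obey every roof**: `θ₂ = 1 ⟹ t·θ₁ ≤ (1−θ₀) + R·(1−θ₂)` for `t ≤ 1` and any `R`.
[cite: CoppersmithWinograd1982, Thm. 1] -/
theorem roof_of_face {F : SpectralMap K} (hF : IsUniversalSpectralPoint K F) (h2 : specMMPoint K F 2 = 1)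
    {t : ℝ} (R : ℝ) (ht : t ≤ 1) :
    t * specMMPoint K F 1 ≤ (1 - specMMPoint K F 0) + R * (1 - specMMPoint K F 2) := by
  have h := face_light hF h2
  have hθ1 := (AlmanLi2026.prop42_mem_Icc hF 1).1
  rw [h2, sub_self, mul_zero, add_zero]
  nlinarith

/-! ## §2 From thin clauses to the corner modulus -/

set_option maxHeartbeats 400000 in
/-- ★★ **MODULUS FROM CLAUSES**: if the thin roof clause holds at every rate `c > c₀` (`c₀ ≥ 0`), then for every
`κ > c₀` there is `u₀` such that every universal spectral point over `ℂ` off the face with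
`u = log(θ₁/(1−θ₂)) ≥ u₀` satisfies `(θ₀+θ₁+θ₂−2)·u ≤ κ·θ₁`.  Proof: `c = (c₀+κ)/2`, `η = (κ−c)/(κ+c)`, clause `c` at
`s = c/((1−η)u)`: `e^{c/s}·ε₂ = e^{(1−η)u}·θ₁e^{−u} = θ₁e^{−ηu}`, so `d ≤ sθ₁ + θ₁e^{−ηu}` and
`d·u ≤ θ₁(c/(1−η) + u e^{−ηu}) ≤ θ₁((κ+c)/2 + 2/(η²u)) ≤ κθ₁`. [cite: Strassen1988, Thm. 3.8]
[cite: CoppersmithWinograd1990, §8] -/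
theorem modulus_of_roofClauses {c₀ : ℝ} (hc₀ : 0 ≤ c₀)
    (h : ∀ c : ℝ, c₀ < c → ∃ t₀ : ℝ, t₀ < 1 ∧ ∀ t : ℝ, t₀ ≤ t → t < 1 →
      ∀ F : SpectralMap ℂ, IsUniversalSpectralPoint ℂ F →
        t * specMMPoint ℂ F 1 ≤
          (1 - specMMPoint ℂ F 0) + Real.exp (c / (1 - t)) * (1 - specMMPoint ℂ F 2))
    (κ : ℝ) (hκ : c₀ < κ) :
    ∃ u₀ : ℝ, ∀ F : SpectralMap ℂ, IsUniversalSpectralPoint ℂ F → specMMPoint ℂ F 2 < 1 →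
      u₀ ≤ Real.log (specMMPoint ℂ F 1 / (1 - specMMPoint ℂ F 2)) →
        (specMMPoint ℂ F 0 + specMMPoint ℂ F 1 + specMMPoint ℂ F 2 - 2) *
            Real.log (specMMPoint ℂ F 1 / (1 - specMMPoint ℂ F 2)) ≤ κ * specMMPoint ℂ F 1 := by
  -- the auxiliary rate c and the fraction η
  obtain ⟨c, hc₀c, hcκ⟩ : ∃ c : ℝ, c₀ < c ∧ c < κ := ⟨(c₀ + κ) / 2, by linarith, by linarith⟩
  have hc : 0 < c := lt_of_le_of_lt hc₀ hc₀c
  obtain ⟨t₀, ht₀, hcl⟩ := h c hc₀c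
  have hκc : 0 < κ + c := by linarith
  obtain ⟨η, hη0, hη1, hcη⟩ : ∃ η : ℝ, 0 < η ∧ η < 1 ∧ c / (1 - η) = (κ + c) / 2 := by
    refine ⟨(κ - c) / (κ + c), div_pos (by linarith) hκc, by rw [div_lt_one hκc]; linarith, ?_⟩
    have : 1 - (κ - c) / (κ + c) = 2 * c / (κ + c) := by field_simp; ring
    rw [this]
    field_simp
  have h1η : 0 < 1 - η := by linarith
  have hs₀0 : 0 < 1 - t₀ := by linarith
  refine ⟨max 1 (max (c / ((1 - η) * (1 - t₀))) (4 / (η ^ 2 * (κ - c)))), fun F hF h2 hu => ?_⟩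
  set θ₀ := specMMPoint ℂ F 0 with hθ₀def
  set θ₁ := specMMPoint ℂ F 1 with hθ₁def
  set θ₂ := specMMPoint ℂ F 2 with hθ₂def
  have hθ1nn : 0 ≤ θ₁ := (AlmanLi2026.prop42_mem_Icc hF 1).1
  have hε0 : 0 ≤ 1 - θ₀ := sub_nonneg.2 (AlmanLi2026.prop42_mem_Icc hF 0).2
  have hε2 : 0 < 1 - θ₂ := by linarith
  have hu1 : 1 ≤ Real.log (θ₁ / (1 - θ₂)) := le_trans (le_max_left _ _) hu
  have huA : c / ((1 - η) * (1 - t₀)) ≤ Real.log (θ₁ / (1 - θ₂)) :=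
    le_trans (le_trans (le_max_left _ _) (le_max_right _ _)) hu
  have huB : 4 / (η ^ 2 * (κ - c)) ≤ Real.log (θ₁ / (1 - θ₂)) :=
    le_trans (le_trans (le_max_right _ _) (le_max_right _ _)) hu
  -- θ₁ > 0 (else the logarithm vanishes)
  have hθ1 : 0 < θ₁ := by
    rcases hθ1nn.eq_or_lt with h0 | h0
    · exfalso
      have : Real.log (θ₁ / (1 - θ₂)) = 0 := by rw [← h0, zero_div, Real.log_zero]
      linarith
    · exact h0
  have hq : 0 < θ₁ / (1 - θ₂) := div_pos hθ1 hε2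
  have hexpu : Real.exp (Real.log (θ₁ / (1 - θ₂))) = θ₁ / (1 - θ₂) := Real.exp_log hq
  set u := Real.log (θ₁ / (1 - θ₂)) with hudef
  have hu0 : 0 < u := by linarith
  -- the length s = c / ((1-η) u) and the instant t = 1 - s
  have hs : 0 < c / ((1 - η) * u) := div_pos hc (mul_pos h1η hu0)
  have hs_le : c / ((1 - η) * u) ≤ 1 - t₀ := by
    rw [div_le_iff₀ (mul_pos h1η hu0)]
    have := (div_le_iff₀ (mul_pos h1η hs₀0)).1 huA
    nlinarith
  have hcl' := hcl (1 - c / ((1 - η) * u)) (by linarith) (by linarith) F hF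
  have hexp_id : c / (1 - (1 - c / ((1 - η) * u))) = (1 - η) * u := by
    rw [sub_sub_cancel, div_div_eq_mul_div, mul_div_cancel_left₀ _ hc.ne']
  rw [hexp_id] at hcl'
  -- e^{(1-η)u} ε₂ = θ₁ e^{-ηu}
  have hkey : Real.exp ((1 - η) * u) * (1 - θ₂) = θ₁ / Real.exp (η * u) := by
    have e1 : (1 - η) * u = u - η * u := by ring
    rw [e1, Real.exp_sub, hexpu]
    field_simp
  rw [← hθ₀def, ← hθ₁def, ← hθ₂def, hkey, sub_mul, one_mul] at hcl'
  -- d ≤ s θ₁ + θ₁ / e^{ηu}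
  have hd : θ₀ + θ₁ + θ₂ - 2 ≤ c / ((1 - η) * u) * θ₁ + θ₁ / Real.exp (η * u) := by linarith
  have hdu : (θ₀ + θ₁ + θ₂ - 2) * u ≤ (c / ((1 - η) * u) * θ₁ + θ₁ / Real.exp (η * u)) * u :=
    mul_le_mul_of_nonneg_right hd hu0.le
  have hR : (c / ((1 - η) * u) * θ₁ + θ₁ / Real.exp (η * u)) * u =
      θ₁ * (c / (1 - η)) + θ₁ * (u / Real.exp (η * u)) := by
    field_simp
  -- u e^{-ηu} ≤ 2/(η² u) ≤ (κ - c)/2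
  have hpow : (η * u) ^ 2 / 2 ≤ Real.exp (η * u) := by
    have := Real.pow_div_factorial_le_exp (x := η * u) (hx := by positivity) (n := 2)
    simpa [Nat.factorial] using this
  have hux : u / Real.exp (η * u) ≤ 2 / (η ^ 2 * u) := by
    rw [div_le_div_iff₀ (Real.exp_pos _) (by positivity)]
    nlinarith
  have huxB : 2 / (η ^ 2 * u) ≤ (κ - c) / 2 := by
    rw [div_le_div_iff₀ (by positivity) two_pos]
    have := (div_le_iff₀ (by positivity : (0 : ℝ) < η ^ 2 * (κ - c))).1 huB
    nlinarith
  have hsum : θ₁ * (c / (1 - η)) + θ₁ * (u / Real.exp (η * u)) ≤ κ * θ₁ := by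
    rw [hcη]
    have := mul_le_mul_of_nonneg_left (hux.trans huxB) hθ1nn
    nlinarith
  linarith [hdu, hR.le, hR.ge]

/-! ## §3 From the corner modulus to thin clauses -/

/-- ★★ **CLAUSES FROM MODULUS**: if `(θ₀+θ₁+θ₂−2)·u ≤ κ·θ₁` at every universal spectral point over `ℂ` off the
face with `u = log(θ₁/(1−θ₂)) ≥ u₀` (`κ ≥ 0`), then the thin roof clause holds at every rate `c > κ`, with
`t₀ = 1 − min(c/max(u₀,1), c−κ)`.  [cite: Strassen1988, Thm. 3.8] [cite: LottiRomani1983, Prop. 4.1] -/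
theorem roofClauses_of_modulus {κ : ℝ} (hκ : 0 ≤ κ) {u₀ : ℝ}
    (h : ∀ F : SpectralMap ℂ, IsUniversalSpectralPoint ℂ F → specMMPoint ℂ F 2 < 1 →
      u₀ ≤ Real.log (specMMPoint ℂ F 1 / (1 - specMMPoint ℂ F 2)) →
        (specMMPoint ℂ F 0 + specMMPoint ℂ F 1 + specMMPoint ℂ F 2 - 2) *
            Real.log (specMMPoint ℂ F 1 / (1 - specMMPoint ℂ F 2)) ≤ κ * specMMPoint ℂ F 1)
    (c : ℝ) (hc : κ < c) :
    ∃ t₀ : ℝ, t₀ < 1 ∧ ∀ t : ℝ, t₀ ≤ t → t < 1 →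
      ∀ F : SpectralMap ℂ, IsUniversalSpectralPoint ℂ F →
        t * specMMPoint ℂ F 1 ≤
          (1 - specMMPoint ℂ F 0) + Real.exp (c / (1 - t)) * (1 - specMMPoint ℂ F 2) := by
  have hc0 : 0 < c := lt_of_le_of_lt hκ hc
  have hu₁ : 1 ≤ max u₀ 1 := le_max_right _ _
  have hu₁0 : 0 < max u₀ 1 := by linarith
  have hs₁ : 0 < min (c / max u₀ 1) (c - κ) := lt_min (div_pos hc0 hu₁0) (by linarith)
  refine ⟨1 - min (c / max u₀ 1) (c - κ), by linarith, fun t ht ht1 F hF => ?_⟩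
  have hs0 : 0 < 1 - t := by linarith
  have hsA : 1 - t ≤ c / max u₀ 1 := by linarith [min_le_left (c / max u₀ 1) (c - κ)]
  have hsB : 1 - t ≤ c - κ := by linarith [min_le_right (c / max u₀ 1) (c - κ)]
  set θ₀ := specMMPoint ℂ F 0 with hθ₀def
  set θ₁ := specMMPoint ℂ F 1 with hθ₁def
  set θ₂ := specMMPoint ℂ F 2 with hθ₂def
  have hθ1nn : 0 ≤ θ₁ := (AlmanLi2026.prop42_mem_Icc hF 1).1
  have hε0 : 0 ≤ 1 - θ₀ := sub_nonneg.2 (AlmanLi2026.prop42_mem_Icc hF 0).2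
  have hθ2le : θ₂ ≤ 1 := (AlmanLi2026.prop42_mem_Icc hF 2).2
  have hR1 : 1 ≤ Real.exp (c / (1 - t)) := Real.one_le_exp (div_nonneg hc0.le hs0.le)
  have hcs : max u₀ 1 ≤ c / (1 - t) := by
    rw [le_div_iff₀ hs0]
    have := (le_div_iff₀ hu₁0).1 hsA
    linarith
  by_cases h2 : θ₂ = 1
  · exact roof_of_face hF h2 _ ht1.le
  have hε2 : 0 < 1 - θ₂ := sub_pos.2 (lt_of_le_of_ne hθ2le h2)
  have htθ : t * θ₁ ≤ θ₁ := by nlinarith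
  by_cases hlow : Real.log (θ₁ / (1 - θ₂)) < max u₀ 1
  · -- shallow points: θ₁ < e^{u₁} ε₂ ≤ e^{c/(1-t)} ε₂
    have hθ1le : θ₁ ≤ Real.exp (c / (1 - t)) * (1 - θ₂) := by
      rcases hθ1nn.eq_or_lt with h0 | h0
      · rw [← h0]; positivity
      · have hq : 0 < θ₁ / (1 - θ₂) := div_pos h0 hε2
        have h1 : θ₁ / (1 - θ₂) < Real.exp (max u₀ 1) := by
          rw [← Real.exp_log hq]; exact Real.exp_lt_exp.2 hlow
        have h2' : θ₁ / (1 - θ₂) ≤ Real.exp (c / (1 - t)) := h1.le.trans (Real.exp_le_exp.2 hcs)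
        rwa [div_le_iff₀ hε2] at h2'
    linarith
  · push Not at hlow
    have hmod := h F hF (lt_of_le_of_ne hθ2le h2) (le_trans (le_max_left _ _) hlow)
    rw [← hθ₀def, ← hθ₁def, ← hθ₂def] at hmod
    have hu0 : 0 < Real.log (θ₁ / (1 - θ₂)) := by linarith
    have hθ1 : 0 < θ₁ := by
      rcases hθ1nn.eq_or_lt with h0 | h0
      · exfalso
        have : Real.log (θ₁ / (1 - θ₂)) = 0 := by rw [← h0, zero_div, Real.log_zero]
        linarith
      · exact h0
    have hq : 0 < θ₁ / (1 - θ₂) := div_pos hθ1 hε2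
    have hexpu : Real.exp (Real.log (θ₁ / (1 - θ₂))) = θ₁ / (1 - θ₂) := Real.exp_log hq
    set u := Real.log (θ₁ / (1 - θ₂)) with hudef
    have hε2R : (1 - θ₂) ≤ Real.exp (c / (1 - t)) * (1 - θ₂) := le_mul_of_one_le_left hε2.le hR1
    by_cases hus : κ ≤ u * (1 - t)
    · -- deep-and-slow: d ≤ κθ₁/u ≤ (1-t) θ₁
      have h1 : (θ₀ + θ₁ + θ₂ - 2) * u ≤ ((1 - t) * θ₁) * u := by
        refine hmod.trans ?_
        nlinarith [mul_le_mul_of_nonneg_right hus hθ1nn]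
      have hd : θ₀ + θ₁ + θ₂ - 2 ≤ (1 - t) * θ₁ := le_of_mul_le_mul_right h1 hu0
      have hd' : θ₀ + θ₁ + θ₂ - 2 ≤ θ₁ - t * θ₁ := by
        linarith [hd, show (1 - t) * θ₁ = θ₁ - t * θ₁ by ring]
      linarith
    · -- deep-and-fast: e^{c/(1-t)} ε₂ = θ₁ e^{c/(1-t) - u} ≥ θ₁
      push Not at hus
      have hularge : u ≤ c / (1 - t) := by
        rw [le_div_iff₀ hs0]; nlinarith
      have hε2eq : 1 - θ₂ = θ₁ / Real.exp u := by
        rw [hexpu]; field_simp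
      have hRε : θ₁ ≤ Real.exp (c / (1 - t)) * (1 - θ₂) := by
        rw [hε2eq]
        calc θ₁ = Real.exp u * (θ₁ / Real.exp u) := by field_simp
          _ ≤ Real.exp (c / (1 - t)) * (θ₁ / Real.exp u) :=
            mul_le_mul_of_nonneg_right (Real.exp_le_exp.2 hularge) (by positivity)
      linarith

/-! ## §4 The one-number form of the crux, and the proved bound -/

/-- ★★★ **`SubexpSaturation ⟺ κ*(ℂ) = 0`**: the deciding crux holds iff for every `κ > 0` there is `u₀` with
`(θ₀+θ₁+θ₂−2)·log(θ₁/(1−θ₂)) ≤ κ·θ₁` at every universal spectral point over `ℂ` off the face `{θ₂ = 1}` whose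
logarithmic height-to-depth ratio `log(θ₁/(1−θ₂))` is at least `u₀` — i.e. iff the CORNER MODULUS
`κ*(ℂ) = limsup_{u → ∞} d·u/θ₁` of the complex matrix-multiplication spectrum vanishes.
[cite: Strassen1988, Thm. 3.8] [cite: AlmanDuanVassilevskaWilliamsXuXuZhou2025, §3.4] -/
theorem subexpSaturation_iff_modulus :
    SubexpSaturation ↔ ∀ κ : ℝ, 0 < κ → ∃ u₀ : ℝ, ∀ F : SpectralMap ℂ, IsUniversalSpectralPoint ℂ F →
      specMMPoint ℂ F 2 < 1 → u₀ ≤ Real.log (specMMPoint ℂ F 1 / (1 - specMMPoint ℂ F 2)) →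
        (specMMPoint ℂ F 0 + specMMPoint ℂ F 1 + specMMPoint ℂ F 2 - 2) *
            Real.log (specMMPoint ℂ F 1 / (1 - specMMPoint ℂ F 2)) ≤ κ * specMMPoint ℂ F 1 := by
  rw [subexpSaturation_iff_roof]
  constructor
  · intro h κ hκ
    exact modulus_of_roofClauses le_rfl (fun c hc => h c hc) κ hκ
  · intro h c hc
    obtain ⟨u₀, hu⟩ := h (c / 2) (by positivity)
    exact roofClauses_of_modulus (by positivity : (0 : ℝ) ≤ c / 2) hu c (by linarith)

/-- ★★ **PROVED: `κ*(ℂ) ≤ c₂ = (5 log(5/4) + 3 log 2)/3 = 1.0650…`** — the lineage's certified thin rates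
(`clause(c)` for every `c > c₂`, `cornerRoof_above_classCeiling`) are an upper bound on the corner modulus: for every
`κ > c₂` there is `u₀` with `(θ₀+θ₁+θ₂−2)·log(θ₁/(1−θ₂)) ≤ κ·θ₁` at every universal spectral point over `ℂ` with
`log(θ₁/(1−θ₂)) ≥ u₀`. [cite: CoppersmithWinograd1990, §8] [cite: Strassen1988, Thm. 3.8] -/
theorem modulus_above_classCeiling (κ : ℝ) (hκ : (5 * Real.log (5 / 4) + 3 * Real.log 2) / 3 < κ) :
    ∃ u₀ : ℝ, ∀ F : SpectralMap ℂ, IsUniversalSpectralPoint ℂ F → specMMPoint ℂ F 2 < 1 →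
      u₀ ≤ Real.log (specMMPoint ℂ F 1 / (1 - specMMPoint ℂ F 2)) →
        (specMMPoint ℂ F 0 + specMMPoint ℂ F 1 + specMMPoint ℂ F 2 - 2) *
            Real.log (specMMPoint ℂ F 1 / (1 - specMMPoint ℂ F 2)) ≤ κ * specMMPoint ℂ F 1 :=
  modulus_of_roofClauses classCeiling_pos.le (fun c hc => cornerRoof_above_classCeiling c hc) κ hκ

/-- ★ **Dichotomy, assembled**: `SubexpSaturation ⟺` the modulus law `d·u ≤ κθ₁ (u ≥ u₀(κ))` for every
`κ ∈ (0, c₂]` — the rates above `c₂` are theorems. [cite: CoppersmithWinograd1990, §8] [cite: Strassen1988, Thm. 3.8] -/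
theorem subexpSaturation_iff_modulus_le_classCeiling :
    SubexpSaturation ↔ ∀ κ : ℝ, 0 < κ → κ ≤ (5 * Real.log (5 / 4) + 3 * Real.log 2) / 3 →
      ∃ u₀ : ℝ, ∀ F : SpectralMap ℂ, IsUniversalSpectralPoint ℂ F →
        specMMPoint ℂ F 2 < 1 → u₀ ≤ Real.log (specMMPoint ℂ F 1 / (1 - specMMPoint ℂ F 2)) →
          (specMMPoint ℂ F 0 + specMMPoint ℂ F 1 + specMMPoint ℂ F 2 - 2) *
              Real.log (specMMPoint ℂ F 1 / (1 - specMMPoint ℂ F 2)) ≤ κ * specMMPoint ℂ F 1 := by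
  rw [subexpSaturation_iff_modulus]
  refine ⟨fun h κ hκ _ => h κ hκ, fun h κ hκ => ?_⟩
  by_cases hle : κ ≤ (5 * Real.log (5 / 4) + 3 * Real.log 2) / 3
  · exact h κ hκ hle
  · push Not at hle
    exact modulus_above_classCeiling κ hle

/-- **The modulus law at one scale gives every slower clause, unconditionally packaged**: for every `κ ≥ 0`,
(`∃ u₀`, modulus law `κ`) `⟹ ∀ c > κ`, roof clause `c`; in particular a proof of the modulus law at ANY single
`κ < c₂` would certify thin rates the Coppersmith–Winograd class cannot (class floor `c⋆ = 1.0645958`).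
[cite: CoppersmithWinograd1990, §8] [cite: Strassen1988, Thm. 3.8] -/
theorem roofClause_of_modulus_any {κ : ℝ} (hκ : 0 ≤ κ)
    (h : ∃ u₀ : ℝ, ∀ F : SpectralMap ℂ, IsUniversalSpectralPoint ℂ F → specMMPoint ℂ F 2 < 1 →
      u₀ ≤ Real.log (specMMPoint ℂ F 1 / (1 - specMMPoint ℂ F 2)) →
        (specMMPoint ℂ F 0 + specMMPoint ℂ F 1 + specMMPoint ℂ F 2 - 2) *
            Real.log (specMMPoint ℂ F 1 / (1 - specMMPoint ℂ F 2)) ≤ κ * specMMPoint ℂ F 1)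
    (c : ℝ) (hc : κ < c) :
    ∃ t₀ : ℝ, t₀ < 1 ∧ ∀ t : ℝ, t₀ ≤ t → t < 1 →
      ∃ r : ℝ, 1 ≤ r ∧ r ≤ Real.exp (c / (1 - t)) ∧ omegaRect ℂ 1 t r ≤ 1 + r := by
  obtain ⟨u₀, hu⟩ := h
  exact (clause_iff_roofClause (hκ.trans hc.le)).2 (roofClauses_of_modulus hκ hu c hc)

end Summit.MatrixMultiplication.MatrixMultiplication.Theorems.SaturationLadderCornerModulus

end
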